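import Mathlib

/-!
# Inertia form of the weighted-dissipativity sentence: an INDEFINITE weight counts the unstable eigenvalues (instab3 g7, cell `ns-blowup`, 2026-08-27)

HONEST FRAMING (human ruling D-0035): nothing here is a claim about Navier–Stokes blow-up.
WHAT THIS IS NOT: not NS evidence. This is the FORMAT theorem behind the «INERTIA-3L» certificates of
`HOME/instab3/PREREG-INERTIA-3L.md` / INSTAB3-METHOD §14 (MODEL: the forced-ABC linearisation restricted to
one symmetry class; the certificate scripts `i3lyap.py` / `i3lyapcert.py` check a finite matrix inequality).
It generalises the positive-weight exclusion sentence
`Summit.NavierStokesRegularity.FluidComputer.LyapunovEigenvalueExclusion.re_eigenvalue_le_of_generator_form_on`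
(cap g6): there a weight `G ≻ 0` with `Re⟪G w, A w⟫ ≤ ω Re⟪G w, w⟫` puts every eigenvalue in `Re λ ≤ ω`, so the
weight must sit ABOVE the spectral abscissa. Here the weight `G = G*` may be INDEFINITE, and the conclusion is a
COUNT (Ostrowski–Schneider / Taussky inertia, negative-definite half): if

  (L⁻)  `Re⟪G w, A w⟫ < 0` for every nonzero `w` in the domain `D`,

then (i) every eigenpair `A v = μ v` (`v ∈ D`, `v ≠ 0`) has `Re μ · Re⟪G v, v⟫ < 0` — no eigenvalue on the
imaginary axis, unstable eigenvectors are `G`-negative; (ii) on every finite-dimensional `A`-invariant subspace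
`V ⊆ D` all of whose eigenvalues have `Re ≥ 0` the form `Re⟪G v, v⟫` is NEGATIVE DEFINITE; hence (iii) if
`Re⟪G x, x⟫ ≥ 0` whenever `x ∈ D` is orthogonal to `m` given vectors `e₁ … eₘ` (the weight has «at most `m`
negative directions»), then `dim V ≤ m`: `A` has at most `m` eigenvalues with `Re ≥ 0` counted with algebraic
multiplicity (Jordan chains inside `D`). Applied to `A − a`, this is «at most `m` eigenvalues with `Re λ ≥ a`»,
the weight sitting BELOW the leader — which is what turns a dissipativity certificate into RIGHTMOST-NESS +
SIMPLICITY + SPECTRAL GAP of a certified leader (with the tree's enclosures `CertificateAbcSpectrum.Row3002` etc.).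

The proof of (ii) is purely algebraic (no semigroup, no resolvent compactness, no Cayley transform): induction
on `dim V` along an `A`-invariant hyperplane `ker φ` (`φ` an eigenvector of the dual map, eigenvalue `β`, which
is an eigenvalue of `A|_V`), the form being negative on the hyperplane by induction and on its form-orthogonal
complement `u` by (L⁻) at `u`: `Re⟪G u, A u⟫ = Re β · Re⟪G u, u⟫`.

* `form_neg_of_apply_neg` — the finite-dimensional core (ii) for an abstract Hermitian form `s` (additive and
  `ℂ`-linear in the second slot, `s x y = conj (s y x)`) and `B : V →ₗ[ℂ] V` whose eigenvalues have `Re ≥ 0`: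
  `(∀ v ≠ 0, Re s v (B v) < 0) → ∀ v ≠ 0, Re s v v < 0`.
* `re_eigenvalue_mul_form_neg` — (i) in the operator setting.
* `form_neg_on_invariant_of_generator_form_neg`, `finrank_le_of_generator_form_neg` — (ii), (iii) in the
  operator setting: `E` an inner-product space, `D` a submodule, `A : D →ₗ[ℂ] E`, `G : E →ₗ[ℂ] E` symmetric.

Mathlib only; no new definitions; std axioms.
-/

namespace Summit.NavierStokesRegularity.FluidComputer.LyapunovInertiaCount

universe u

open Module Module.End
open scoped ComplexConjugate

/-! ## §1 Algebra of a slotwise Hermitian form -/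

section Form

variable {V : Type*} [AddCommGroup V] [Module ℂ V]

omit [AddCommGroup V] [Module ℂ V] in
/-- Diagonal values of a Hermitian form are real. -/
theorem form_self_im (s : V → V → ℂ) (herm : ∀ x y, s x y = conj (s y x)) (x : V) : (s x x).im = 0 := by
  have h := herm x x
  have := congrArg Complex.im h
  rw [Complex.conj_im] at this
  linarith

/-- Left slot: conjugate-homogeneous (from Hermitian symmetry and right homogeneity). -/
theorem form_smul_left (s : V → V → ℂ) (hsmul : ∀ x y (c : ℂ), s x (c • y) = c * s x y)
    (herm : ∀ x y, s x y = conj (s y x)) (c : ℂ) (x y : V) : s (c • x) y = conj c * s x y := by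
  rw [herm (c • x) y, hsmul, map_mul, ← herm x y]

omit [Module ℂ V] in
/-- Left slot: additive. -/
theorem form_add_left (s : V → V → ℂ) (hadd : ∀ x y z, s x (y + z) = s x y + s x z)
    (herm : ∀ x y, s x y = conj (s y x)) (x y z : V) : s (x + y) z = s x z + s y z := by
  rw [herm (x + y) z, hadd, map_add, ← herm x z, ← herm y z]

/-- Right slot: zero. -/
theorem form_zero_right (s : V → V → ℂ) (hsmul : ∀ x y (c : ℂ), s x (c • y) = c * s x y) (x : V) :
    s x 0 = 0 := by
  simpa using hsmul x 0 0

/-- Left slot: zero. -/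
theorem form_zero_left (s : V → V → ℂ) (hsmul : ∀ x y (c : ℂ), s x (c • y) = c * s x y)
    (herm : ∀ x y, s x y = conj (s y x)) (y : V) : s 0 y = 0 := by
  rw [herm, form_zero_right s hsmul, map_zero]

/-- Right slot: subtraction. -/
theorem form_sub_right (s : V → V → ℂ) (hadd : ∀ x y z, s x (y + z) = s x y + s x z)
    (hsmul : ∀ x y (c : ℂ), s x (c • y) = c * s x y) (x y z : V) : s x (y - z) = s x y - s x z := by
  rw [sub_eq_add_neg, hadd, ← neg_one_smul ℂ z, hsmul]; ring

/-- The right slot as a bundled linear functional. -/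
theorem exists_linearMap_right (s : V → V → ℂ) (hadd : ∀ x y z, s x (y + z) = s x y + s x z)
    (hsmul : ∀ x y (c : ℂ), s x (c • y) = c * s x y) (x : V) :
    ∃ f : V →ₗ[ℂ] ℂ, ∀ y, f y = s x y :=
  ⟨{ toFun := fun y => s x y, map_add' := fun y z => hadd x y z,
     map_smul' := fun c y => by rw [hsmul]; rfl }, fun _ => rfl⟩

/-- Expansion of the diagonal value along `v = w + t • u` when `u` is form-orthogonal to `w`. -/
theorem form_self_add_smul (s : V → V → ℂ) (hadd : ∀ x y z, s x (y + z) = s x y + s x z)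
    (hsmul : ∀ x y (c : ℂ), s x (c • y) = c * s x y) (herm : ∀ x y, s x y = conj (s y x))
    (w u : V) (t : ℂ) (horth : s w u = 0) :
    s (w + t • u) (w + t • u) = s w w + (conj t * t) * s u u := by
  have h1 : s u w = 0 := by rw [herm, horth, map_zero]
  rw [form_add_left s hadd herm, hadd, hadd, form_smul_left s hsmul herm, form_smul_left s hsmul herm,
    hsmul, hsmul, horth, h1]
  ring

end Form

/-! ## §2 The finite-dimensional core: the form is negative definite on an invariant subspace with `Re σ ≥ 0` -/

section Core

/-- **Negative-definiteness from (L⁻), finite-dimensional core** (Ostrowski–Schneider / Taussky, the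
negative-definite half, algebraic proof). `V` a finite-dimensional complex space, `s` a Hermitian form
(additive and linear in the second slot, `s x y = conj (s y x)`), `B : V →ₗ[ℂ] V` all of whose eigenvalues
have nonnegative real part. If `Re s v (B v) < 0` for every `v ≠ 0`, then `Re s v v < 0` for every `v ≠ 0`.
(Induction on `dim V` along the `B`-invariant hyperplane `ker φ`, `φ` an eigenvector of the dual map.) -/
theorem form_neg_of_apply_neg :
    ∀ (n : ℕ) (V : Type u) [AddCommGroup V] [Module ℂ V] [FiniteDimensional ℂ V],
      finrank ℂ V = n →
      ∀ (s : V → V → ℂ), (∀ x y z, s x (y + z) = s x y + s x z) → (∀ x y (c : ℂ), s x (c • y) = c * s x y) →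
        (∀ x y, s x y = conj (s y x)) →
      ∀ (B : Module.End ℂ V), (∀ μ : ℂ, B.HasEigenvalue μ → 0 ≤ μ.re) →
        (∀ v : V, v ≠ 0 → (s v (B v)).re < 0) → ∀ v : V, v ≠ 0 → (s v v).re < 0 := by
  intro n
  induction n using Nat.strong_induction_on with
  | _ n ih =>
  intro V _ _ _ hn s hadd hsmul herm B hev hL v hv
  -- `V` is nontrivial
  haveI : Nontrivial V := nontrivial_of_ne v 0 hv
  -- an eigenvector `φ` of the dual map: `φ ∘ B = β • φ`
  haveI : Nontrivial (Module.Dual ℂ V) := by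
    apply Module.nontrivial_of_finrank_pos (R := ℂ)
    rw [Subspace.dual_finrank_eq]; exact Module.finrank_pos
  obtain ⟨β, hβ⟩ := Module.End.exists_eigenvalue B.dualMap
  obtain ⟨φ, hφ⟩ := hβ.exists_hasEigenvector
  have hφB : ∀ x : V, φ (B x) = β * φ x := by
    intro x
    have h := hφ.apply_eq_smul
    have := congrArg (fun g : Module.Dual ℂ V => g x) h
    simpa [LinearMap.dualMap_apply'] using this
  have hφ0 : φ ≠ 0 := hφ.2
  -- the invariant hyperplane `W = ker φ`
  set W : Submodule ℂ V := LinearMap.ker φ with hWdef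
  have hWinv : ∀ x ∈ W, B x ∈ W := by
    intro x hx
    rw [hWdef, LinearMap.mem_ker] at hx ⊢
    rw [hφB, hx, mul_zero]
  -- `β` is an eigenvalue of `B`, hence `0 ≤ Re β`
  have hβB : B.HasEigenvalue β := by
    set Bβ : Module.End ℂ V := B - β • (1 : Module.End ℂ V) with hBβ
    have hBβx : ∀ x : V, Bβ x = B x - β • x := fun x => by
      simp [hBβ, LinearMap.sub_apply, LinearMap.smul_apply]
    have hns : ¬ Function.Surjective Bβ := by
      intro hsurj
      apply hφ0
      ext x
      obtain ⟨y, rfl⟩ := hsurj x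
      rw [hBβx, map_sub, map_smul, hφB, smul_eq_mul, sub_self, LinearMap.zero_apply]
    have hni : ¬ Function.Injective Bβ := by
      rwa [LinearMap.injective_iff_surjective]
    rw [Function.Injective] at hni
    push Not at hni
    obtain ⟨x, y, hxy, hne⟩ := hni
    have hz : Bβ (x - y) = 0 := by rw [map_sub, hxy, sub_self]
    refine Module.End.hasEigenvalue_of_hasEigenvector (x := x - y) ⟨?_, sub_ne_zero.mpr hne⟩
    rw [Module.End.mem_eigenspace_iff]
    have : B (x - y) - β • (x - y) = 0 := by rw [← hBβx]; exact hz
    exact sub_eq_zero.mp this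
  have hβre : 0 ≤ β.re := hev β hβB
  -- dimension of `W`
  have hφsurj : Function.Surjective φ := by
    obtain ⟨x, hx⟩ : ∃ x, φ x ≠ 0 := by
      by_contra h
      push Not at h
      exact hφ0 (LinearMap.ext h)
    intro c
    refine ⟨(c / φ x) • x, ?_⟩
    rw [map_smul, smul_eq_mul, div_mul_cancel₀ c hx]
  have hWdim : finrank ℂ W + 1 = n := by
    have h1 := LinearMap.finrank_range_add_finrank_ker φ
    rw [LinearMap.range_eq_top.mpr hφsurj, finrank_top, Module.finrank_self] at h1
    rw [hWdef]; omega
  -- induction hypothesis on `W` with the restricted form and operator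
  set BW : Module.End ℂ W := LinearMap.restrict B hWinv with hBWdef
  have ihW : ∀ w : W, w ≠ 0 → (s w w).re < 0 := by
    refine ih (finrank ℂ W) (by omega) W rfl (fun x y => s x y) (fun x y z => by simp [hadd])
      (fun x y c => by simp [hsmul]) (fun x y => herm x y) BW ?_ ?_
    · intro μ hμ
      apply hev μ
      obtain ⟨w, hw⟩ := hμ.exists_hasEigenvector
      refine Module.End.hasEigenvalue_of_hasEigenvector (x := (w : V)) ⟨?_, ?_⟩
      · rw [Module.End.mem_eigenspace_iff]
        have h := hw.apply_eq_smul
        have := congrArg (fun z : W => (z : V)) h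
        simpa [hBWdef, LinearMap.restrict_apply] using this
      · simpa using hw.2
    · intro w hw
      have : (s w (B w)).re < 0 := hL w (by simpa using hw)
      simpa [hBWdef, LinearMap.restrict_apply] using this
  -- form-orthogonality to `W`: `s w u = 0` for all `w ∈ W`
  -- a nonzero `u` with `s w u = 0 ∀ w ∈ W`, from rank–nullity of `Ψ u = (s (b i) u)_i`
  obtain ⟨u, hu_orth, hu0⟩ : ∃ u : V, (∀ w ∈ W, s w u = 0) ∧ u ≠ 0 := by
    let b := Module.finBasis ℂ W
    choose f hf using exists_linearMap_right s hadd hsmul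
    let Ψ : V →ₗ[ℂ] (Fin (finrank ℂ W) → ℂ) := LinearMap.pi fun i => f (b i : V)
    have hker : 0 < finrank ℂ (LinearMap.ker Ψ) := by
      have h1 := LinearMap.finrank_range_add_finrank_ker Ψ
      have h2 : finrank ℂ (LinearMap.range Ψ) ≤ finrank ℂ W := by
        calc finrank ℂ (LinearMap.range Ψ) ≤ finrank ℂ (Fin (finrank ℂ W) → ℂ) := Submodule.finrank_le _
          _ = finrank ℂ W := by simp
      omega
    obtain ⟨u, hu⟩ := (Module.finrank_pos_iff_exists_ne_zero (R := ℂ) (M := LinearMap.ker Ψ)).mp hker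
    refine ⟨(u : V), ?_, by simpa using hu⟩
    -- `s (b i) u = 0` for all `i`, hence `s w u = 0` on `W` by conjugate-linearity in the left slot
    have hi : ∀ i, s (b i : V) u = 0 := by
      intro i
      have hm := u.2
      rw [LinearMap.mem_ker] at hm
      have := congrFun hm i
      simpa [Ψ, hf] using this
    -- the functional `w ↦ conj (s w u) = s u w` is linear and vanishes on the basis
    intro w hw
    obtain ⟨g, hg⟩ := exists_linearMap_right s hadd hsmul (u : V)
    have hgz : g ∘ₗ W.subtype = 0 := by
      apply b.ext
      intro i
      simp only [LinearMap.comp_apply, Submodule.subtype_apply, LinearMap.zero_apply, hg]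
      rw [herm, hi, map_zero]
    have := congrArg (fun h : W →ₗ[ℂ] ℂ => h ⟨w, hw⟩) hgz
    simp only [LinearMap.comp_apply, Submodule.subtype_apply, LinearMap.zero_apply, hg] at this
    rw [herm, this, map_zero]
  -- `u ∉ W` (else `s u u = 0`, contradicting the induction hypothesis), i.e. `φ u ≠ 0`
  have hφu : φ u ≠ 0 := by
    intro h0
    have huW : u ∈ W := by rw [hWdef, LinearMap.mem_ker]; exact h0
    have h1 := ihW ⟨u, huW⟩ (by simpa using hu0)
    have h2 : s u u = 0 := hu_orth u huW
    simp [h2] at h1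
  -- `B u = w₁ + β • u` with `w₁ ∈ W`
  have hBu : B u - β • u ∈ W := by
    rw [hWdef, LinearMap.mem_ker, map_sub, map_smul, hφB, smul_eq_mul, sub_self]
  -- (L⁻) at `u`: `Re s u (B u) = Re β · Re s u u < 0`, hence `Re s u u < 0`
  have hsuu_im : (s u u).im = 0 := form_self_im s herm u
  have huneg : (s u u).re < 0 := by
    have h := hL u hu0
    have hsplit : s u (B u) = β * s u u := by
      have : B u = (B u - β • u) + β • u := by abel
      rw [this, hadd, hsmul]
      have hz : s u (B u - β • u) = 0 := by
        rw [herm, hu_orth _ hBu, map_zero]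
      rw [hz, zero_add]
    rw [hsplit, Complex.mul_re, hsuu_im, mul_zero, sub_zero] at h
    rcases hβre.lt_or_eq with hpos | hzero
    · exact (mul_neg_iff.mp h).resolve_right (fun hh => absurd hpos (not_lt.mpr hh.1.le)) |>.2
    · rw [← hzero, zero_mul] at h; exact absurd h (lt_irrefl 0)
  -- general `v`: `v = w + t • u` with `w ∈ W`, `t = φ v / φ u`
  set t : ℂ := φ v / φ u with htdef
  have hwW : v - t • u ∈ W := by
    rw [hWdef, LinearMap.mem_ker, map_sub, map_smul, smul_eq_mul, htdef, div_mul_cancel₀ _ hφu, sub_self]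
  have hdecomp : v = (v - t • u) + t • u := by abel
  have horth : s (v - t • u) u = 0 := hu_orth _ hwW
  rw [hdecomp, form_self_add_smul s hadd hsmul herm _ u t horth]
  have htt : conj t * t = ((Complex.normSq t : ℝ) : ℂ) := by rw [Complex.normSq_eq_conj_mul_self]
  rw [htt, Complex.add_re, Complex.re_ofReal_mul]
  by_cases hw0 : v - t • u = 0
  · have ht0 : t ≠ 0 := by
      intro ht; apply hv; rw [hdecomp, hw0, ht, zero_smul, add_zero]
    rw [hw0, form_zero_left s hsmul herm, Complex.zero_re, zero_add]
    exact mul_neg_of_pos_of_neg (Complex.normSq_pos.mpr ht0) huneg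
  · have h1 := ihW ⟨v - t • u, hwW⟩ (by simpa using hw0)
    have h2 : Complex.normSq t * (s u u).re ≤ 0 :=
      mul_nonpos_of_nonneg_of_nonpos (Complex.normSq_nonneg t) huneg.le
    simpa using add_lt_of_lt_of_nonpos (by simpa using h1) h2

end Core

/-! ## §3 The operator setting: an inner-product space `E`, a domain `D`, `A : D →ₗ[ℂ] E`, a symmetric weight `G` -/

section Operator

open scoped InnerProductSpace

variable {E : Type*} [NormedAddCommGroup E] [InnerProductSpace ℂ E]

/-- **(i) Sign relation at an eigenvector.** For a symmetric weight `G` and (L⁻) on the domain `D`: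
every eigenpair `A v = μ • v` with `v ∈ D`, `v ≠ 0` has `Re μ · Re⟪G v, v⟫ < 0`. In particular there is
NO eigenvalue with `Re μ = 0`, and eigenvectors of eigenvalues with `Re μ > 0` are `G`-negative. -/
theorem re_eigenvalue_mul_form_neg {G : E →ₗ[ℂ] E} (hG : ∀ x y : E, ⟪G x, y⟫_ℂ = ⟪x, G y⟫_ℂ)
    {D : Submodule ℂ E} {A : D →ₗ[ℂ] E} (hL : ∀ w : D, w ≠ 0 → (⟪G w, A w⟫_ℂ).re < 0)
    {v : D} (hv : v ≠ 0) {μ : ℂ} (hμ : A v = μ • (v : E)) :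
    μ.re * (⟪G v, v⟫_ℂ).re < 0 := by
  have h := hL v hv
  have him : (⟪G (v : E), (v : E)⟫_ℂ).im = 0 := by
    have h1 : conj ⟪G (v : E), (v : E)⟫_ℂ = ⟪G (v : E), (v : E)⟫_ℂ := by
      rw [inner_conj_symm, ← hG]
    have := congrArg Complex.im h1
    rw [Complex.conj_im] at this
    linarith
  rw [hμ, inner_smul_right, Complex.mul_re, him, mul_zero, sub_zero] at h
  exact h

/-- (i), corollary: no eigenvalue on the imaginary axis. -/
theorem re_eigenvalue_ne_zero {G : E →ₗ[ℂ] E} (hG : ∀ x y : E, ⟪G x, y⟫_ℂ = ⟪x, G y⟫_ℂ)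
    {D : Submodule ℂ E} {A : D →ₗ[ℂ] E} (hL : ∀ w : D, w ≠ 0 → (⟪G w, A w⟫_ℂ).re < 0)
    {v : D} (hv : v ≠ 0) {μ : ℂ} (hμ : A v = μ • (v : E)) : μ.re ≠ 0 := by
  intro h0
  have h := re_eigenvalue_mul_form_neg hG hL hv hμ
  rw [h0, zero_mul] at h
  exact lt_irrefl 0 h

/-- **(ii) The weight form is negative definite on every finite-dimensional invariant subspace with
`Re σ ≥ 0`.** `G` symmetric, (L⁻) on `D`, `V ≤ D` finite-dimensional with `A V ⊆ V` and every eigenvalue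
of `A|_V` of nonnegative real part ⇒ `Re⟪G v, v⟫ < 0` for all nonzero `v ∈ V`. -/
theorem form_neg_on_invariant_of_generator_form_neg {G : E →ₗ[ℂ] E}
    (hG : ∀ x y : E, ⟪G x, y⟫_ℂ = ⟪x, G y⟫_ℂ)
    {D : Submodule ℂ E} {A : D →ₗ[ℂ] E} (hL : ∀ w : D, w ≠ 0 → (⟪G w, A w⟫_ℂ).re < 0)
    (V : Submodule ℂ E) [FiniteDimensional ℂ V] (hVD : V ≤ D)
    (hAV : ∀ (v : E) (hv : v ∈ V), A ⟨v, hVD hv⟩ ∈ V)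
    (hev : ∀ (μ : ℂ) (v : E) (hv : v ∈ V), v ≠ 0 → A ⟨v, hVD hv⟩ = μ • v → 0 ≤ μ.re) :
    ∀ v ∈ V, v ≠ 0 → (⟪G v, v⟫_ℂ).re < 0 := by
  -- the restriction `B : V →ₗ V` of `A`
  let B : Module.End ℂ V :=
    { toFun := fun v => ⟨A ⟨v, hVD v.2⟩, hAV v v.2⟩
      map_add' := fun x y => by
        apply Subtype.ext
        change A ⟨((x + y : V) : E), hVD (x + y).2⟩ = A ⟨x, hVD x.2⟩ + A ⟨y, hVD y.2⟩
        have : (⟨((x + y : V) : E), hVD (x + y).2⟩ : D) = ⟨x, hVD x.2⟩ + ⟨y, hVD y.2⟩ := rfl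
        rw [this, map_add]
      map_smul' := fun c x => by
        apply Subtype.ext
        change A ⟨((c • x : V) : E), hVD (c • x).2⟩ = c • A ⟨x, hVD x.2⟩
        have : (⟨((c • x : V) : E), hVD (c • x).2⟩ : D) = c • ⟨x, hVD x.2⟩ := rfl
        rw [this, map_smul] }
  have hB : ∀ v : V, ((B v : V) : E) = A ⟨v, hVD v.2⟩ := fun v => rfl
  -- the form `s x y = ⟪G x, y⟫` on `V`
  let s : V → V → ℂ := fun x y => ⟪G (x : E), (y : E)⟫_ℂ
  have hadd : ∀ x y z : V, s x (y + z) = s x y + s x z := fun x y z => by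
    simp only [s, Submodule.coe_add, inner_add_right]
  have hsmul : ∀ (x y : V) (c : ℂ), s x (c • y) = c * s x y := fun x y c => by
    simp only [s, Submodule.coe_smul, inner_smul_right]
  have herm : ∀ x y : V, s x y = conj (s y x) := fun x y => by
    simp only [s]; rw [inner_conj_symm, ← hG]
  have hevB : ∀ μ : ℂ, B.HasEigenvalue μ → 0 ≤ μ.re := by
    intro μ hμ
    obtain ⟨w, hw⟩ := hμ.exists_hasEigenvector
    have hw0 : (w : E) ≠ 0 := by
      intro h; exact hw.2 (Subtype.ext h)
    refine hev μ (w : E) w.2 hw0 ?_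
    have h := congrArg (fun z : V => (z : E)) hw.apply_eq_smul
    simpa [hB] using h
  have hLB : ∀ v : V, v ≠ 0 → (s v (B v)).re < 0 := by
    intro v hv0
    have hne : (⟨(v : E), hVD v.2⟩ : D) ≠ 0 := by
      intro h; apply hv0; apply Subtype.ext
      exact congrArg (fun z : D => (z : E)) h
    simpa [s, hB] using hL ⟨(v : E), hVD v.2⟩ hne
  intro v hv hv0
  have h := form_neg_of_apply_neg (finrank ℂ V) V rfl s hadd hsmul herm B hevB hLB ⟨v, hv⟩
    (by intro h; exact hv0 (congrArg (fun z : V => (z : E)) h))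
  simpa [s] using h

/-- **(iii) The count.** If, in addition, the weight is nonnegative on the part of `D` orthogonal to `m`
given vectors `e₁, …, eₘ` («at most `m` negative directions»), then every finite-dimensional `A`-invariant
`V ≤ D` with `Re σ(A|_V) ≥ 0` has `dim V ≤ m`: `A` has at most `m` eigenvalues with nonnegative real part,
counted with algebraic multiplicity. (For `A − a·1`: at most `m` eigenvalues with `Re λ ≥ a`.) -/
theorem finrank_le_of_generator_form_neg {G : E →ₗ[ℂ] E}
    (hG : ∀ x y : E, ⟪G x, y⟫_ℂ = ⟪x, G y⟫_ℂ)
    {D : Submodule ℂ E} {A : D →ₗ[ℂ] E} (hL : ∀ w : D, w ≠ 0 → (⟪G w, A w⟫_ℂ).re < 0)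
    {m : ℕ} (e : Fin m → E) (hK : ∀ x ∈ D, (∀ i, ⟪e i, x⟫_ℂ = 0) → 0 ≤ (⟪G x, x⟫_ℂ).re)
    (V : Submodule ℂ E) [FiniteDimensional ℂ V] (hVD : V ≤ D)
    (hAV : ∀ (v : E) (hv : v ∈ V), A ⟨v, hVD hv⟩ ∈ V)
    (hev : ∀ (μ : ℂ) (v : E) (hv : v ∈ V), v ≠ 0 → A ⟨v, hVD hv⟩ = μ • v → 0 ≤ μ.re) :
    finrank ℂ V ≤ m := by
  have hneg := form_neg_on_invariant_of_generator_form_neg hG hL V hVD hAV hev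
  -- `Ψ v = (⟪e i, v⟫)_i` is injective on `V`
  let f : Fin m → (V →ₗ[ℂ] ℂ) := fun i =>
    { toFun := fun v => ⟪e i, (v : E)⟫_ℂ
      map_add' := fun x y => by simp only [Submodule.coe_add, inner_add_right]
      map_smul' := fun c x => by simp only [Submodule.coe_smul, inner_smul_right, smul_eq_mul, RingHom.id_apply] }
  let Ψ : V →ₗ[ℂ] (Fin m → ℂ) := LinearMap.pi f
  have hinj : Function.Injective Ψ := by
    rw [← LinearMap.ker_eq_bot, Submodule.eq_bot_iff]
    intro v hv
    rw [LinearMap.mem_ker] at hv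
    by_contra h0
    have h1 : ∀ i, ⟪e i, (v : E)⟫_ℂ = 0 := fun i => by
      have := congrFun hv i
      simpa [Ψ, f] using this
    have h2 := hK (v : E) (hVD v.2) h1
    have h3 := hneg (v : E) v.2 (by intro h; exact h0 (Subtype.ext h))
    linarith
  calc finrank ℂ V ≤ finrank ℂ (Fin m → ℂ) := LinearMap.finrank_le_finrank_of_injective hinj
    _ = m := by simp

end Operator

end Summit.NavierStokesRegularity.FluidComputer.LyapunovInertiaCount
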